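import Summits.QuantumFields.YangMills.Theorems.F4SubCurvatureDoorSubCurvatureClauseLatticeToAxis
import Summits.QuantumFields.YangMills.Theorems.ForcedResponseSkewnessRunningCouplingCeilingCovAxisDomination
import HarnessLib

/-!
# Route `F4SubCurvatureDoor`, crux `SubCurvatureClause` ⟨stmt-QuantumFields-23763⟩ — the soft stub `LatticeToAxis` of the REGISTERED
# symmetrised skeleton `Cruxes/SubCurvatureClause/Lines/rp_moebius_ladder.lean` (`129694558f839039`, director-ym RULING 2026-08-30T00:18:09Z),
# UNCONDITIONALLY

Helper file (`--supports stmt-QuantumFields-23763 --as helper`; free-hands seat `ym-line-frs-p2` g20).  Definition-free, 0 sorry, standard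
axioms.  No item is closed; no summit, no crux and no mass gap is proved by this file.

g19's ✓`latticeToAxis_of_axisDomination` (`…SubCurvatureClauseLatticeToAxis`, p749489) proves the two-sided letter GIVEN the axis-domination
statement (the consequent of `CurvatureKernel.AxisDominationOfForm`, whose module the build farm does not serve).  `axisDomination_holds` (§1)
discharges that hypothesis from the served re-run ✓`sq_torusCov_le_lcc_mul_lcc` (`…RunningCouplingCeilingCovAxisDomination`, p752832: reflection
positivity of the odd torus, Gram pair of the reflected density at height `⌈n/2⌉` and the density at height `⌊n/2⌋`), and ★ `latticeToAxis` (§2) is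
the registered stub's letter verbatim (`E4 = EuclideanSpace ℝ (Fin 4)`), so `stub_latticeToAxis` closes by
`exact Summit.QuantumFields.YangMills.Theorems.F4SubCurvatureDoorSubCurvatureClauseLatticeToAxisTwoSided.latticeToAxis`.

[cite: OsterwalderSeiler1978, §2].  HONEST LABEL: a soft stub; `MoebiusRow` (XL) / `CrossoverDecay` (L–XL), ⟨23763⟩, ⟨24275⟩ OPEN; the Yang–Mills
mass gap is NOT proved; no summit is proved by a line.
-/

set_option autoImplicit false

noncomputable section

open scoped SchwartzMap
open MeasureTheory Filter Topology
open Literature.MathematicalPhysics.QuantumFieldTheory Literature.MathematicalPhysics.QuantumLattice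
open Literature.MathematicalPhysics.AQFT
open Literature.Probability.LatticeModels (Site)
open Summit.QuantumFields.YangMills.Cruxes.OSLegsFromFemtoAndGap.DlrCollarTransfer (dens torusE MomentBounds6)
open Summit.QuantumFields.YangMills.Theorems.ROT (IsLegScheme OffDiagLimitAlong)
open Summit.QuantumFields.YangMills.Theorems.F4SubCurvatureDoorSubCurvatureClauseMixedAxisDomination (dens_zero_apply)
open Summit.QuantumFields.YangMills.Theorems.F4SubCurvatureDoorSubCurvatureClauseLatticeToAxis (latticeToAxis_of_axisDomination)
open Summit.QuantumFields.YangMills.Cruxes.RunningCouplingCeiling.Pointwise (torusCov)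
open Summit.QuantumFields.YangMills.Theorems.ForcedResponseSkewnessRunningCouplingCeilingCovAxisDomination (sq_torusCov_le_lcc_mul_lcc)

namespace Summit.QuantumFields.YangMills.Theorems.F4SubCurvatureDoorSubCurvatureClauseLatticeToAxisTwoSided

/-! ## §1 The axis-domination statement, served -/

/-- **Axis domination of the plain plaquette covariance** in the lifted-integral letters of `CurvatureKernel.AxisDominationOfForm` (its exact
consequent): for `β ≥ 0`, `z 0 = n`, `3 ≤ n ≤ L` on the odd torus `2L+1`,
`Cov(Q_0,Q_z)² ≤ lCC(Q,Q^θ,2⌈n/2⌉) · lCC(Q^θ,Q,2⌊n/2⌋)` with both factors `≥ 0`. [cite: OsterwalderSeiler1978, §2] -/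
theorem axisDomination_holds :
    ∀ (G : Type) [Group G] [TopologicalSpace G] [IsTopologicalGroup G] [CompactSpace G] [MeasurableSpace G] [BorelSpace G]
      (r : LatticeRep G) (β : ℝ), 0 ≤ β → ∀ (L : ℕ) (z : Site 4) (n : ℕ), z 0 = n → 3 ≤ n → n ≤ L →
      0 ≤ latticeConnectedCorr r.ρ β (2 * L + 1) r.curvature.timeReflect.F r.curvature.F (2 * (n / 2)) ∧
      0 ≤ latticeConnectedCorr r.ρ β (2 * L + 1) r.curvature.F r.curvature.timeReflect.F (2 * ((n + 1) / 2)) ∧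
      ((∫ U, r.curvature.F (torusLift (2 * L + 1) U) * r.curvature.F (configShift (-z) (torusLift (2 * L + 1) U))
            ∂(wilsonMeasure r.ρ β : MeasureTheory.Measure (GaugeConfig 4 (2 * L + 1) G))) -
          (∫ U, r.curvature.F (torusLift (2 * L + 1) U) ∂(wilsonMeasure r.ρ β : MeasureTheory.Measure (GaugeConfig 4 (2 * L + 1) G))) *
          (∫ U, r.curvature.F (configShift (-z) (torusLift (2 * L + 1) U))
            ∂(wilsonMeasure r.ρ β : MeasureTheory.Measure (GaugeConfig 4 (2 * L + 1) G)))) ^ 2 ≤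
        latticeConnectedCorr r.ρ β (2 * L + 1) r.curvature.F r.curvature.timeReflect.F (2 * ((n + 1) / 2)) *
          latticeConnectedCorr r.ρ β (2 * L + 1) r.curvature.timeReflect.F r.curvature.F (2 * (n / 2)) := by
  intro G _ _ _ _ _ _ r β hβ L z n hz0 hn3 hnL
  have key := sq_torusCov_le_lcc_mul_lcc r hβ L (n / 2) ((n + 1) / 2) (by omega) (by omega) (by omega) 0 z
    (by rw [hz0, Pi.zero_apply, sub_zero]; push_cast; omega)
  have e : torusCov G r β L 0 z =
      (∫ U, r.curvature.F (torusLift (2 * L + 1) U) * r.curvature.F (configShift (-z) (torusLift (2 * L + 1) U))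
            ∂(wilsonMeasure r.ρ β : MeasureTheory.Measure (GaugeConfig 4 (2 * L + 1) G))) -
          (∫ U, r.curvature.F (torusLift (2 * L + 1) U) ∂(wilsonMeasure r.ρ β : MeasureTheory.Measure (GaugeConfig 4 (2 * L + 1) G))) *
          (∫ U, r.curvature.F (configShift (-z) (torusLift (2 * L + 1) U))
            ∂(wilsonMeasure r.ρ β : MeasureTheory.Measure (GaugeConfig 4 (2 * L + 1) G))) := by
    unfold torusCov torusE
    simp only [dens_zero_apply]
    rfl
  rw [e] at key
  exact ⟨key.2.1, key.1, key.2.2⟩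

/-! ## §2 ★ The registered stub letter -/

/-- ★ **`LatticeToAxis`** — the soft stub `stub_latticeToAxis` of the registered skeleton `Cruxes/SubCurvatureClause/Lines/rp_moebius_ladder.lean`
(⟨stmt-QuantumFields-23763⟩, line «rp-moebius-ladder», symmetrised letters) in its letter, unconditionally: an eventual bound `B ≥ 0` on BOTH
orders of the on-axis lattice coupling at lattice scales `2t a_k ∈ [u(1−θ), u(1+θ)]` along the subsequence bounds `u⁸ |K(u e₀)|` by
`((1+θ)/(1−θ))⁸ B`. [cite: OsterwalderSeiler1978, §2] [cite: OS1973, §2] -/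
theorem latticeToAxis : ∀ (G : Type) [Group G] [TopologicalSpace G] [IsTopologicalGroup G] [CompactSpace G],
    IsCompactSimpleLieGroup G →
    letI : MeasurableSpace G := borel G
    haveI : BorelSpace G := ⟨rfl⟩
    ∀ (r : LatticeRep G) (a : ℝ → ℝ), (∀ β, 0 < a β) → Tendsto a atTop (nhds 0) → MomentBounds6 G r a →
      ∀ sch : SpeciesScheme (YMSpecies G), IsLegScheme a sch → ∀ φ : ℕ → ℕ, Tendsto φ atTop atTop →
      ∀ S₁ : SchwingerFamily (EuclideanSpace ℝ (Fin 4)), OffDiagLimitAlong r sch φ S₁ →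
      ∀ K : EuclideanSpace ℝ (Fin 4) → ℝ, ContinuousOn K {x : EuclideanSpace ℝ (Fin 4) | x ≠ 0} →
      (∀ F : 𝓢((Fin 2 → EuclideanSpace ℝ (Fin 4)), ℂ), IsOffDiagonal F →
        HasCompactSupport (F : (Fin 2 → EuclideanSpace ℝ (Fin 4)) → ℂ) →
        Integrable (fun x : Fin 2 → EuclideanSpace ℝ (Fin 4) => (K (x 0 - x 1) : ℂ) * F x) ∧
          S₁ 2 F = ∫ x : Fin 2 → EuclideanSpace ℝ (Fin 4), (K (x 0 - x 1) : ℂ) * F x) →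
      ∀ (u θ B : ℝ), 0 < u → 0 < θ → θ < 1 → 0 ≤ B →
        (∀ᶠ k in atTop, ∀ t : ℕ, u * (1 - θ) ≤ 2 * t * sch.a (φ k) → 2 * t * sch.a (φ k) ≤ u * (1 + θ) →
          ((2 * t : ℕ) : ℝ) ^ 8 * latticeConnectedCorr r.ρ (sch.β (φ k)) (2 * sch.L (φ k) + 1)
              r.curvature.timeReflect.F r.curvature.F (2 * t) ≤ B ∧
          ((2 * t : ℕ) : ℝ) ^ 8 * latticeConnectedCorr r.ρ (sch.β (φ k)) (2 * sch.L (φ k) + 1)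
              r.curvature.F r.curvature.timeReflect.F (2 * t) ≤ B) →
        u ^ 8 * |K (EuclideanSpace.single 0 u)| ≤ (1 + θ) ^ 8 / (1 - θ) ^ 8 * B :=
  latticeToAxis_of_axisDomination axisDomination_holds

end Summit.QuantumFields.YangMills.Theorems.F4SubCurvatureDoorSubCurvatureClauseLatticeToAxisTwoSided

end
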